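import Summits.CriticalPhenomena.PercolationContinuityZ3.Theorems.PercNearOneGluingNoHeavyLowerTailKnQuestion8CoefficientwiseCoreClassKernelMixHubWalls
import HarnessLib

/-!
# Words on a path by end colours: parity, blue runs, fills (PATH LEMMA of hub-Kleitman: transport lemmas, memo §1.3/§1.6)

Support file (`--supports stmt-CriticalPhenomena-4575`, closed), prover `prim-cplus-coupling` (gen 51).  No definitions, no notations,
no named facts, no sorries; standard axioms.  Memo `prim-cplus-coupling/A5-COUPLING-gen51.md` §1.3, §1.6.

Consequences of the wall dictionary `…KernelMixHubWalls` organised by the END COLOURS of a word `ω ⊆ [1, ℓ]` (the three levels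
BB < {RB, BR} < RR of memo-50 §2.8): the parity of `#D(ω)` is the parity of 'first colour ≠ last colour' (`hubPath_even_walls_iff`);
a blue-starting word has all its red edges above `min D` (`hubPath_lt_of_mem_of_first_blue`), a blue-ending word has them at most `max D`
(`hubPath_le_of_mem_of_last_blue`); constant words (`hubPath_eq_empty_of_first_blue`, `hubPath_walls_const`); walls never contain `0` or `ℓ`
(`hubPath_zero_notMem_walls`, `hubPath_top_notMem_walls`); and the walls of a two-sided fill (`hubPath_walls_two_sided_fill`).  These are the
facts used to embed the sources/targets of the path lemma into the augmented family of `…KernelMixHubClosed` (BB ↦ `D`, RB ↦ `{0} ∪ D`,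
BR ↦ `D ∪ {ℓ}`) in `…KernelMixHubPathCore`.
[cite: KozmaNitzan2024, Questions 8–9 (§5.5 p. 36) (context)]
-/

namespace Summit.CriticalPhenomena.PercolationContinuityZ3.Theorems

open Finset
open scoped symmDiff

namespace Coefficientwise

/-- `0` is never a wall. [folklore] -/
theorem hubPath_zero_notMem_walls (ℓ : ℕ) (D : Finset ℕ → Finset ℕ)
    (hD : ∀ ω, D ω = (Icc 1 (ℓ - 1)).filter (fun k => ¬ (k ∈ ω ↔ k + 1 ∈ ω))) (ω : Finset ℕ) : 0 ∉ D ω := by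
  intro h
  have := walls_bounds ℓ D hD ω 0 h
  omega

/-- `ℓ` is never a wall (`ℓ ≥ 1`). [folklore] -/
theorem hubPath_top_notMem_walls (ℓ : ℕ) (hℓ : 1 ≤ ℓ) (D : Finset ℕ → Finset ℕ)
    (hD : ∀ ω, D ω = (Icc 1 (ℓ - 1)).filter (fun k => ¬ (k ∈ ω ↔ k + 1 ∈ ω))) (ω : Finset ℕ) : ℓ ∉ D ω := by
  intro h
  have := walls_bounds ℓ D hD ω ℓ h
  omega

/-- Walls are at most `ℓ - 1`. [folklore] -/
theorem hubPath_walls_le (ℓ : ℕ) (D : Finset ℕ → Finset ℕ)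
    (hD : ∀ ω, D ω = (Icc 1 (ℓ - 1)).filter (fun k => ¬ (k ∈ ω ↔ k + 1 ∈ ω))) (ω : Finset ℕ) :
    ∀ e ∈ D ω, e ≤ ℓ - 1 := fun e he => (walls_bounds ℓ D hD ω e he).2

/-- Walls are at least `1`. [folklore] -/
theorem hubPath_walls_ge (ℓ : ℕ) (D : Finset ℕ → Finset ℕ)
    (hD : ∀ ω, D ω = (Icc 1 (ℓ - 1)).filter (fun k => ¬ (k ∈ ω ↔ k + 1 ∈ ω))) (ω : Finset ℕ) :
    ∀ e ∈ D ω, 1 ≤ e := fun e he => (walls_bounds ℓ D hD ω e he).1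

/-- `#D(ω)` is even iff the first and the last edge have the same colour. [folklore] -/
theorem hubPath_even_walls_iff (ℓ : ℕ) (hℓ : 1 ≤ ℓ) (D : Finset ℕ → Finset ℕ)
    (hD : ∀ ω, D ω = (Icc 1 (ℓ - 1)).filter (fun k => ¬ (k ∈ ω ↔ k + 1 ∈ ω))) (ω : Finset ℕ) :
    Even (D ω).card ↔ (1 ∈ ω ↔ ℓ ∈ ω) := by
  have h := walls_last_iff ℓ hℓ D hD ω
  tauto

/-- A blue-starting word has all its red edges strictly above `min D`. [folklore] -/
theorem hubPath_lt_of_mem_of_first_blue (ℓ : ℕ) (D : Finset ℕ → Finset ℕ)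
    (hD : ∀ ω, D ω = (Icc 1 (ℓ - 1)).filter (fun k => ¬ (k ∈ ω ↔ k + 1 ∈ ω))) (ω : Finset ℕ) (hω : ω ⊆ Icc 1 ℓ)
    (h1 : 1 ∉ ω) (h : (D ω).Nonempty) : ∀ k ∈ ω, (D ω).min' h < k := by
  intro k hk
  have hkb := Finset.mem_Icc.mp (hω hk)
  by_contra hc
  push Not at hc
  have := (walls_run_left ℓ D hD ω h k hkb.1 hc).mp hk
  exact h1 this

/-- A blue-ending word has all its red edges at most `max D`. [folklore] -/
theorem hubPath_le_of_mem_of_last_blue (ℓ : ℕ) (D : Finset ℕ → Finset ℕ)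
    (hD : ∀ ω, D ω = (Icc 1 (ℓ - 1)).filter (fun k => ¬ (k ∈ ω ↔ k + 1 ∈ ω))) (ω : Finset ℕ) (hω : ω ⊆ Icc 1 ℓ)
    (hℓ : ℓ ∉ ω) (h : (D ω).Nonempty) : ∀ k ∈ ω, k ≤ (D ω).max' h := by
  intro k hk
  have hkb := Finset.mem_Icc.mp (hω hk)
  by_contra hc
  push Not at hc
  have := (walls_run_right ℓ D hD ω h k (by omega) hkb.2).mp hk
  exact hℓ this

/-- A blue-starting word without walls is all blue. [folklore] -/
theorem hubPath_eq_empty_of_first_blue (ℓ : ℕ) (D : Finset ℕ → Finset ℕ)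
    (hD : ∀ ω, D ω = (Icc 1 (ℓ - 1)).filter (fun k => ¬ (k ∈ ω ↔ k + 1 ∈ ω))) (ω : Finset ℕ) (hω : ω ⊆ Icc 1 ℓ)
    (h1 : 1 ∉ ω) (h0 : D ω = ∅) : ω = ∅ := by
  rw [Finset.eq_empty_iff_forall_notMem]
  intro k hk
  have hkb := Finset.mem_Icc.mp (hω hk)
  have := ((walls_eq_empty_iff ℓ D hD ω).mp h0 k hkb.1 hkb.2).mp hk
  exact h1 this

/-- A red-starting word without walls is all red. [folklore] -/
theorem hubPath_eq_full_of_first_red (ℓ : ℕ) (D : Finset ℕ → Finset ℕ)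
    (hD : ∀ ω, D ω = (Icc 1 (ℓ - 1)).filter (fun k => ¬ (k ∈ ω ↔ k + 1 ∈ ω))) (ω : Finset ℕ) (hω : ω ⊆ Icc 1 ℓ)
    (h1 : 1 ∈ ω) (h0 : D ω = ∅) : ω = Icc 1 ℓ := by
  apply Finset.Subset.antisymm hω
  intro k hk
  have hkb := Finset.mem_Icc.mp hk
  exact ((walls_eq_empty_iff ℓ D hD ω).mp h0 k hkb.1 hkb.2).mpr h1

/-- Constant words have no walls: `D(∅) = D([1, ℓ]) = ∅`. [folklore] -/
theorem hubPath_walls_const (ℓ : ℕ) (D : Finset ℕ → Finset ℕ)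
    (hD : ∀ ω, D ω = (Icc 1 (ℓ - 1)).filter (fun k => ¬ (k ∈ ω ↔ k + 1 ∈ ω))) :
    D ∅ = ∅ ∧ D (Icc 1 ℓ) = ∅ := by
  constructor
  · exact (walls_eq_empty_iff ℓ D hD ∅).mpr fun k _ _ => by simp
  · refine (walls_eq_empty_iff ℓ D hD (Icc 1 ℓ)).mpr fun k hk1 hk => ?_
    simp only [Finset.mem_Icc]
    omega

/-- Walls of a two-sided fill: prefix `[1, a]` and suffix `[b+1, ℓ]` (`1 ≤ a < b ≤ ℓ-1`, both inside blue runs) toggle `a` and `b`.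
[folklore] -/
theorem hubPath_walls_two_sided_fill (ℓ : ℕ) (D : Finset ℕ → Finset ℕ)
    (hD : ∀ ω, D ω = (Icc 1 (ℓ - 1)).filter (fun k => ¬ (k ∈ ω ↔ k + 1 ∈ ω))) (ω : Finset ℕ)
    (a b : ℕ) (ha : 1 ≤ a) (hab : a < b) (hb : b ≤ ℓ - 1) (hlead : ∀ k ∈ ω, a < k) (htrail : ∀ k ∈ ω, k ≤ b) :
    D (ω ∪ Icc 1 a ∪ Icc (b + 1) ℓ) = D ω ∆ {a} ∆ {b} := by
  have h1 := walls_prefix_fill ℓ D hD ω a ha (by omega) hlead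
  have h2 := walls_suffix_fill ℓ D hD (ω ∪ Icc 1 a) b (by omega) hb (by
    intro k hk
    rcases Finset.mem_union.mp hk with hk | hk
    · exact htrail k hk
    · have := (Finset.mem_Icc.mp hk).2; omega)
  rw [h2, h1]

/-- Toggling a fresh element in and out: `insert x X ∆ {x} = X` for `x ∉ X`. [folklore] -/
theorem hubPath_insert_symmDiff_self (X : Finset ℕ) (x : ℕ) (hx : x ∉ X) : insert x X ∆ {x} = X := by
  ext e
  simp only [Finset.mem_symmDiff, Finset.mem_insert, Finset.mem_singleton]
  constructor
  · rintro (⟨h | h, hne⟩ | ⟨rfl, h⟩)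
    · exact absurd h hne
    · exact h
    · exact absurd (Or.inl rfl) h
  · intro he
    have hne : e ≠ x := fun h => hx (h ▸ he)
    exact Or.inl ⟨Or.inr he, hne⟩

/-- `(insert x X ∆ {a}) ∆ {x} = X ∆ {a}` for `x ∉ X`, `a ≠ x`. [folklore] -/
theorem hubPath_insert_symmDiff_symmDiff_self (X : Finset ℕ) (x a : ℕ) (hx : x ∉ X) (hax : a ≠ x) :
    insert x X ∆ {a} ∆ {x} = X ∆ {a} := by
  ext e
  simp only [Finset.mem_symmDiff, Finset.mem_insert, Finset.mem_singleton]
  constructor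
  · rintro (⟨(⟨h | h, hna⟩ | ⟨rfl, h⟩), hne⟩ | ⟨rfl, h⟩)
    · exact absurd h hne
    · exact Or.inl ⟨h, hna⟩
    · refine Or.inr ⟨rfl, fun h' => h (Or.inr h')⟩
    · exfalso
      apply h
      exact Or.inl ⟨Or.inl rfl, fun h' => hax h'.symm⟩
  · rintro (⟨he, hna⟩ | ⟨rfl, hna⟩)
    · have hne : e ≠ x := fun h => hx (h ▸ he)
      exact Or.inl ⟨Or.inl ⟨Or.inr he, hna⟩, hne⟩
    · exact Or.inl ⟨Or.inr ⟨rfl, fun h => hna (h.resolve_left hax)⟩, hax⟩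

/-- The symmetric difference with two singletons lies inside `X ∪ {a, b}`: an element bound. [folklore] -/
theorem hubPath_mem_symmDiff_two (X : Finset ℕ) (a b e : ℕ) (he : e ∈ X ∆ {a} ∆ {b}) : e ∈ X ∨ e = a ∨ e = b := by
  simp only [Finset.mem_symmDiff, Finset.mem_singleton] at he
  tauto

end Coefficientwise

end Summit.CriticalPhenomena.PercolationContinuityZ3.Theorems
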